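import Literature.MathematicalPhysics.QuantumLattice.EmeryThreeBandThermalDensities
import HarnessLib

/-!
# GROUND-STATE OBSERVABLES OF THE THREE-BAND MODEL FROM ENERGY WORDS: the Cu / O occupations, the Cu double occupancy and every
# conjugate density of a (near-)ground state at `(θ, ρ)` are bracketed by a cap at `θ` and two floors at `θ ± δ·e_a`

Topic `Literature/MathematicalPhysics/QuantumLattice` (family `hubbard`; crew hubbard-fast S2 «certified observables», seat hubbard-box-p1). The `T = 0`
twin of `EmeryThreeBandThermalDensities`. The router's three-band words are energy floors / caps on `emeryEnergyDensity θ ρ` (the infimum of the cell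
energy over `emeryStates ρ`); the anchor-data bracket of `SuperlatticeCellEnergyFamilies` (`cellEnergy_mem_Icc_of_anchor_data`: a cap `u` on the energy
of a state `ω ∈ S` at `θ` and floors `f_± ≤ e_S(θ ± δe_a)` give `e_{D_a}(ω) ∈ [(f₊ − u)/δ, (u − f₋)/δ]`) turns three such words into a two-sided bracket on
the conjugate density of direction `a` of EVERY state of the class obeying the cap — in particular of every (near-)ground state (`u` = a certified cap on
`e(θ, ρ)` plus the state's excess). For the decorated `CuO₂` model the fourteen conjugate densities are (per site of the decorated lattice):
Cu–O and O–O bond energies (`a < 8`), the Cu / O_x / O_y OCCUPATIONS over four (`a = 8, 9, 10`) and the Cu / O_x / O_y DOUBLE OCCUPANCIES over four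
(`a = 11, 12, 13`). This file records the identifications and the turnkey brackets:

* §1 `cellEnergy_emeryDirections_8/9/10` (`= ρ_Cu(ω)/4`, `ρ_{O_x}(ω)/4`, `ρ_{O_y}(ω)/4`) and `cellEnergy_emeryDirections_11` (`= ⟨n_{Cu↑} n_{Cu↓}⟩_ω/4`).
* §2 **`emery_conjugateDensity_mem_Icc_of_words`**: `ω ∈ emeryStates ρ`, `e_{emeryViews θ}(ω) ≤ u`, `f₊ ≤ e(θ + δe_a, ρ)`, `f₋ ≤ e(θ − δe_a, ρ)` (`δ > 0`) ⇒
  `e_{D_a}(ω) ∈ [(f₊ − u)/δ, (u − f₋)/δ]`; hence **`emery_cuDensity_mem_Icc_of_words`**: `ρ_Cu(ω) ∈ [4(f₊ − u)/δ, 4(u − f₋)/δ]` from a cap at `θ` and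
  floors with the Cu LEVEL moved by `±δ`; `emery_oxDensity_…` / `emery_oyDensity_…`; **`emery_cuDocc_mem_Icc_of_words`** (Cu repulsion moved by `±δ`).
* §3 the (near-)ground-state reading: for a class minimiser (`IsMinOn`) the cap is any certified cap `U ≥ e(θ, ρ)` (`emery_cuDensity_groundState_mem_Icc`);
  for an `ε`-minimiser it is `U + ε`; `ε`-minimisers exist for every `ε > 0` whenever the class is inhabited (`0 ≤ ρ ≤ 3/2`).

Everything is PROVED (0 sorry); no definition, no named fact, no number. HONEST SCOPE: widths are `(window at θ + windows at θ ± δe_a)/δ`; with today's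
three-band windows (≈ 1–2 eV per `CuO₂`) and admissible level shifts `δ ≈ 1–2 eV` the Cu-occupation bracket is of order one electron — the certified
form of the Zhang–Rice «where do the holes go» question, informative only once the windows shrink.

## Tree / Mathlib search

REUSED: `cellEnergy_mem_Icc_of_anchor_data`, `viewFamily`, `infCellEnergyOn(_le_cellEnergy)`, `exists_cellEnergy_lt_of_infCellEnergyOn_lt`
(`SuperlatticeCellEnergyFamilies`); `emeryStates`, `emeryViews`, `emeryDirections`, `emeryEnergyDensity`, `emeryStates_nonempty` (`EmeryThreeBandByDecoration`,
`…StatesNonempty`); `cellEnergy_emeryDirections_eq_cellMeanEnergy` (`EmeryThreeBandClusterFloor`); `cellMeanEnergy_emeryAtoms_8/9/10`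
(`EmeryThreeBandThermalDensities`); `cellMeanEnergy_sublatticeOnSite`, `sublatticeOnSite_apply_cellRes` (`PeriodicSublatticeAndStaggeredTerms`).
`lean search 'emery.*mem_Icc_of_words|cuDensity.*groundState'` (2026-08-28): nothing at T = 0 (the T > 0 brackets are R149).

## References

* R. B. Griffiths, J. Math. Phys. 5 (1964) 1215, eq. (39) (tangent brackets). [cite: Griffiths1964, Eq. (39) and Fig. 3]
* T. Koma, H. Tasaki, J. Stat. Phys. 76 (1994) 745, §1 (conjugate observables from energies). [cite: KomaTasaki1994, §1]
* F. C. Zhang, T. M. Rice, Phys. Rev. B 37 (1988) 3759 (holes on oxygen vs copper). [cite: ZhangRice1988, §II]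
-/

noncomputable section

open scoped ComplexOrder BigOperators
open Finset

namespace Literature.MathematicalPhysics.QuantumLattice

open Matrix HubbardWave0 Literature.Probability.LatticeModels ThermodynamicLimit InfVolFermionState

/-! ### §1. The conjugate densities of the level and repulsion directions are occupations and double occupancies -/

/-- `e_{D_8}(ω) = ρ_Cu(ω)/4`. [cite: PavariniEtAl2001, eq. (1)] -/
theorem cellEnergy_emeryDirections_8 (ω : InfVolFermionState 2) :
    ω.cellEnergy (emeryDirections 8) 1 = (1 / 4 : ℝ) * ω.densityAt cuSite := by
  rw [cellEnergy_emeryDirections_eq_cellMeanEnergy, cellMeanEnergy_emeryAtoms_8]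

/-- `e_{D_9}(ω) = ρ_{O_x}(ω)/4`. [cite: PavariniEtAl2001, eq. (1)] -/
theorem cellEnergy_emeryDirections_9 (ω : InfVolFermionState 2) :
    ω.cellEnergy (emeryDirections 9) 1 = (1 / 4 : ℝ) * ω.densityAt oxSite := by
  rw [cellEnergy_emeryDirections_eq_cellMeanEnergy, cellMeanEnergy_emeryAtoms_9]

/-- `e_{D_10}(ω) = ρ_{O_y}(ω)/4`. [cite: PavariniEtAl2001, eq. (1)] -/
theorem cellEnergy_emeryDirections_10 (ω : InfVolFermionState 2) :
    ω.cellEnergy (emeryDirections 10) 1 = (1 / 4 : ℝ) * ω.densityAt oySite := by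
  rw [cellEnergy_emeryDirections_eq_cellMeanEnergy, cellMeanEnergy_emeryAtoms_10]

/-- `e_{D_11}(ω) = ⟨n_{Cu↑} n_{Cu↓}⟩_ω/4` (the Cu double occupancy over four). [cite: PavariniEtAl2001, eq. (1)] -/
theorem cellEnergy_emeryDirections_11 (ω : InfVolFermionState 2) :
    ω.cellEnergy (emeryDirections 11) 1 =
      (1 / 4 : ℝ) * (ω.expect {cuSite} (nAt cuSite (Finset.mem_singleton_self cuSite) 0 * nAt cuSite (Finset.mem_singleton_self cuSite) 1)).re := by
  have h11 : emeryAtoms 11 = sublatticeOnSite liebPeriods cuSite 0 1 := rfl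
  have hc : cellPos (cellRes liebPeriods cuSite) = cuSite := by decide
  rw [cellEnergy_emeryDirections_eq_cellMeanEnergy, h11, cellMeanEnergy_sublatticeOnSite, sublatticeOnSite_apply_cellRes, card_cell_liebPeriods_eq, hc]
  simp only [Complex.ofReal_zero, zero_smul, Complex.ofReal_one, one_smul, zero_add]
  norm_num

/-! ### §2. Brackets from three energy words -/

/-- **CONJUGATE DENSITY FROM THREE WORDS**: `ω ∈ emeryStates ρ` with `e_{emeryViews θ}(ω) ≤ u`, and floors `f₊ ≤ e(θ + δe_a, ρ)`, `f₋ ≤ e(θ − δe_a, ρ)`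
(`δ > 0`) give `e_{D_a}(ω) ∈ [(f₊ − u)/δ, (u − f₋)/δ]`. [cite: Griffiths1964, Eq. (39) and Fig. 3] [cite: KomaTasaki1994, §1] -/
theorem emery_conjugateDensity_mem_Icc_of_words {ρ : ℝ} {ω : InfVolFermionState 2} (hω : ω ∈ emeryStates ρ) (θ : Fin 14 → ℝ) (a : Fin 14)
    {δ u fplus fminus : ℝ} (hδ : 0 < δ) (hu : ω.cellEnergy (emeryViews θ) 1 ≤ u)
    (hplus : fplus ≤ emeryEnergyDensity (θ + Pi.single a δ) ρ) (hminus : fminus ≤ emeryEnergyDensity (θ - Pi.single a δ) ρ) :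
    ω.cellEnergy (emeryDirections a) 1 ∈ Set.Icc ((fplus - u) / δ) ((u - fminus) / δ) :=
  cellEnergy_mem_Icc_of_anchor_data (S := emeryStates ρ) (fun _ => hubbardFermionInteraction 2 0 0) emeryDirections 1 hω θ a hδ hu hplus hminus

/-- **THE Cu OCCUPATION FROM THREE WORDS**: a cap `u` on the energy of `ω ∈ emeryStates ρ` at `θ` and floors at `θ ± δe_8` (the Cu LEVEL moved by `±δ`)
give `ρ_Cu(ω) ∈ [4(f₊ − u)/δ, 4(u − f₋)/δ]`. [cite: Griffiths1964, Eq. (39) and Fig. 3] [cite: ZhangRice1988, §II] -/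
theorem emery_cuDensity_mem_Icc_of_words {ρ : ℝ} {ω : InfVolFermionState 2} (hω : ω ∈ emeryStates ρ) (θ : Fin 14 → ℝ)
    {δ u fplus fminus : ℝ} (hδ : 0 < δ) (hu : ω.cellEnergy (emeryViews θ) 1 ≤ u)
    (hplus : fplus ≤ emeryEnergyDensity (θ + Pi.single 8 δ) ρ) (hminus : fminus ≤ emeryEnergyDensity (θ - Pi.single 8 δ) ρ) :
    ω.densityAt cuSite ∈ Set.Icc (4 * (fplus - u) / δ) (4 * (u - fminus) / δ) := by
  have h := emery_conjugateDensity_mem_Icc_of_words hω θ 8 hδ hu hplus hminus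
  rw [cellEnergy_emeryDirections_8] at h
  obtain ⟨h1, h2⟩ := h
  constructor
  · rw [mul_div_assoc]; linarith
  · rw [mul_div_assoc]; linarith

/-- **The O_x occupation from three words** (the O_x level moved by `±δ`). [cite: Griffiths1964, Eq. (39) and Fig. 3] -/
theorem emery_oxDensity_mem_Icc_of_words {ρ : ℝ} {ω : InfVolFermionState 2} (hω : ω ∈ emeryStates ρ) (θ : Fin 14 → ℝ)
    {δ u fplus fminus : ℝ} (hδ : 0 < δ) (hu : ω.cellEnergy (emeryViews θ) 1 ≤ u)
    (hplus : fplus ≤ emeryEnergyDensity (θ + Pi.single 9 δ) ρ) (hminus : fminus ≤ emeryEnergyDensity (θ - Pi.single 9 δ) ρ) :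
    ω.densityAt oxSite ∈ Set.Icc (4 * (fplus - u) / δ) (4 * (u - fminus) / δ) := by
  have h := emery_conjugateDensity_mem_Icc_of_words hω θ 9 hδ hu hplus hminus
  rw [cellEnergy_emeryDirections_9] at h
  obtain ⟨h1, h2⟩ := h
  constructor
  · rw [mul_div_assoc]; linarith
  · rw [mul_div_assoc]; linarith

/-- **The O_y occupation from three words** (the O_y level moved by `±δ`). [cite: Griffiths1964, Eq. (39) and Fig. 3] -/
theorem emery_oyDensity_mem_Icc_of_words {ρ : ℝ} {ω : InfVolFermionState 2} (hω : ω ∈ emeryStates ρ) (θ : Fin 14 → ℝ)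
    {δ u fplus fminus : ℝ} (hδ : 0 < δ) (hu : ω.cellEnergy (emeryViews θ) 1 ≤ u)
    (hplus : fplus ≤ emeryEnergyDensity (θ + Pi.single 10 δ) ρ) (hminus : fminus ≤ emeryEnergyDensity (θ - Pi.single 10 δ) ρ) :
    ω.densityAt oySite ∈ Set.Icc (4 * (fplus - u) / δ) (4 * (u - fminus) / δ) := by
  have h := emery_conjugateDensity_mem_Icc_of_words hω θ 10 hδ hu hplus hminus
  rw [cellEnergy_emeryDirections_10] at h
  obtain ⟨h1, h2⟩ := h
  constructor
  · rw [mul_div_assoc]; linarith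
  · rw [mul_div_assoc]; linarith

/-- **THE Cu DOUBLE OCCUPANCY FROM THREE WORDS** (the Cu repulsion moved by `±δ`): `⟨n_{Cu↑}n_{Cu↓}⟩_ω ∈ [4(f₊ − u)/δ, 4(u − f₋)/δ]`.
[cite: Griffiths1964, Eq. (39) and Fig. 3] [cite: KomaTasaki1994, §1] -/
theorem emery_cuDocc_mem_Icc_of_words {ρ : ℝ} {ω : InfVolFermionState 2} (hω : ω ∈ emeryStates ρ) (θ : Fin 14 → ℝ)
    {δ u fplus fminus : ℝ} (hδ : 0 < δ) (hu : ω.cellEnergy (emeryViews θ) 1 ≤ u)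
    (hplus : fplus ≤ emeryEnergyDensity (θ + Pi.single 11 δ) ρ) (hminus : fminus ≤ emeryEnergyDensity (θ - Pi.single 11 δ) ρ) :
    (ω.expect {cuSite} (nAt cuSite (Finset.mem_singleton_self cuSite) 0 * nAt cuSite (Finset.mem_singleton_self cuSite) 1)).re ∈
      Set.Icc (4 * (fplus - u) / δ) (4 * (u - fminus) / δ) := by
  have h := emery_conjugateDensity_mem_Icc_of_words hω θ 11 hδ hu hplus hminus
  rw [cellEnergy_emeryDirections_11] at h
  obtain ⟨h1, h2⟩ := h
  constructor
  · rw [mul_div_assoc]; linarith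
  · rw [mul_div_assoc]; linarith

/-! ### §3. The (near-)ground-state reading -/

/-- **GROUND STATES**: if `ω ∈ emeryStates ρ` minimises the cell energy at `θ` over the class and `U` is any certified cap on `e(θ, ρ)`, then with
floors `f_±` at `θ ± δe_8`: `ρ_Cu(ω) ∈ [4(f₊ − U)/δ, 4(U − f₋)/δ]`. [cite: Griffiths1964, Eq. (39) and Fig. 3] [cite: ZhangRice1988, §II] -/
theorem emery_cuDensity_groundState_mem_Icc {ρ : ℝ} {ω : InfVolFermionState 2} (hω : ω ∈ emeryStates ρ) (θ : Fin 14 → ℝ)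
    (hmin : IsMinOn (fun σ : InfVolFermionState 2 => σ.cellEnergy (emeryViews θ) 1) (emeryStates ρ) ω)
    {δ U fplus fminus : ℝ} (hδ : 0 < δ) (hU : emeryEnergyDensity θ ρ ≤ U)
    (hplus : fplus ≤ emeryEnergyDensity (θ + Pi.single 8 δ) ρ) (hminus : fminus ≤ emeryEnergyDensity (θ - Pi.single 8 δ) ρ) :
    ω.densityAt cuSite ∈ Set.Icc (4 * (fplus - U) / δ) (4 * (U - fminus) / δ) := by
  have he : ω.cellEnergy (emeryViews θ) 1 = emeryEnergyDensity θ ρ :=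
    cellEnergy_eq_infCellEnergyOn_of_isMinOn (emeryViews θ) 1 hω hmin
  exact emery_cuDensity_mem_Icc_of_words hω θ hδ (he.le.trans hU) hplus hminus

/-- **NEAR-GROUND STATES EXIST AND OBEY THE BRACKET WITH SLACK `ε`**: for `0 ≤ ρ ≤ 3/2`, every `ε > 0`, a cap `U ≥ e(θ, ρ)` and floors at `θ ± δe_8`,
some `ω ∈ emeryStates ρ` with energy `< e(θ,ρ) + ε` exists, and EVERY such state has `ρ_Cu(ω) ∈ [4(f₊ − U − ε)/δ, 4(U + ε − f₋)/δ]`.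
[cite: Griffiths1964, Eq. (39) and Fig. 3] [cite: ArakiMoriya2003, §11.1 Theorem 11.2] -/
theorem emery_cuDensity_nearGroundState_mem_Icc {ρ : ℝ} (hρ0 : 0 ≤ ρ) (hρ1 : ρ ≤ 3 / 2) (θ : Fin 14 → ℝ) {ε : ℝ} (hε : 0 < ε)
    {δ U fplus fminus : ℝ} (hδ : 0 < δ) (hU : emeryEnergyDensity θ ρ ≤ U)
    (hplus : fplus ≤ emeryEnergyDensity (θ + Pi.single 8 δ) ρ) (hminus : fminus ≤ emeryEnergyDensity (θ - Pi.single 8 δ) ρ) :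
    (∃ ω ∈ emeryStates ρ, ω.cellEnergy (emeryViews θ) 1 < emeryEnergyDensity θ ρ + ε) ∧
      ∀ ω ∈ emeryStates ρ, ω.cellEnergy (emeryViews θ) 1 ≤ emeryEnergyDensity θ ρ + ε →
        ω.densityAt cuSite ∈ Set.Icc (4 * (fplus - (U + ε)) / δ) (4 * (U + ε - fminus) / δ) := by
  refine ⟨?_, fun ω hω hωε => emery_cuDensity_mem_Icc_of_words hω θ hδ (hωε.trans (by linarith)) hplus hminus⟩
  exact exists_cellEnergy_lt_of_infCellEnergyOn_lt 1 (emeryViews θ) (emeryStates_nonempty hρ0 hρ1) (lt_add_of_pos_right _ hε)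

end Literature.MathematicalPhysics.QuantumLattice

end
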